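import Mathlib.NumberTheory.ArithmeticFunction.VonMangoldt
import Mathlib.NumberTheory.ArithmeticFunction.Moebius
import Mathlib.Data.Nat.Squarefree
import HarnessLib

/-!
# The parity flip at level exactly `1/2`:  `(1 − μ(n)) · θ(n) = 2 Λ(n)` — PROVED

Solo seat `solo-Parity-blind` (summit `Parity`, conjunct `BatemanHorn`).  For a squarefree `n > 1` put

  `θ(n) := ∑_{d ∣ n, d² < n} μ(d) (log n − 2 log d)`   (`= 2 ∑_{d ∣ n, d < √n} μ(d) log (√n / d)`),

the LOWER HALF (divisors below `√n`, i.e. level exactly `1/2`) of the Möbius–log divisor sum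
`∑_{d ∣ n} μ(d) (log n − 2 log d) = 2 Λ(n)`.  The involution `d ↦ n/d` maps the upper half onto the lower
half and multiplies each term by `−μ(n)` (since `μ(n/d) = μ(n) μ(d)` and `log n − 2 log (n/d) =
−(log n − 2 log d)`), whence the identity

* `flip` :            `(1 − μ n) · θ n = 2 Λ n`                         (squarefree `n > 1`);
* `theta_eq_of_moebius_eq_neg_one` : `μ n = −1 ⇒ θ n = Λ n`;
* `theta_eq_zero_of_odd_composite` : `μ n = −1`, `n` not prime `⇒ θ n = 0`;
* `theta_prime` :     `θ p = log p`.

So ON INTEGERS WITH AN ODD NUMBER OF PRIME FACTORS the prime indicator (times `log`) IS a divisor sum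
supported on `d < √n`: a "parity oracle" (Type I information for `a_n 1_{Ω(n) odd}`) of level exactly `1/2`
gives the prime count by an identity — the mechanism behind the conditional theorems of Ram Murty–Vatwani
(twin primes from EH + Möbius equidistribution over shifted primes, JNT 180 (2017)) and Huang–Li
(Goldbach, arXiv:2005.03811, Thm 1: levels `θ + θ' > 1`).  The seat's paper §8 studies what survives at
level `1/2 − ε` (where the identity is no longer available) by a Ford–Maynard type linear programme.
Elementary; no `sorry`, standard axioms.
-/

noncomputable section

open Finset
open ArithmeticFunction
open scoped ArithmeticFunction.Moebius ArithmeticFunction.zeta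

namespace Summit.Parity.BatemanHorn.Theorems.SoloBlindParityFlip

/-- The level-`1/2` half of the Möbius–log divisor sum:
`θ(n) = ∑_{d ∣ n, d·d < n} μ(d) (log n − 2 log d)`. -/
def theta (n : ℕ) : ℝ :=
  ∑ d ∈ n.divisors with d * d < n, (μ d : ℝ) * (Real.log n - 2 * Real.log d)

/-- `∑_{d ∣ n} μ(d) = 0` for `n ≠ 1` (as a real sum). -/
theorem sum_divisors_moebius_eq_zero {n : ℕ} (hn : n ≠ 1) :
    ∑ d ∈ n.divisors, (μ d : ℝ) = 0 := by
  have h := congrArg (fun f : ArithmeticFunction ℝ => f n) (coe_moebius_mul_coe_zeta (R := ℝ))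
  simpa only [coe_mul_zeta_apply, intCoe_apply, one_apply_ne hn] using h

/-- The full Möbius–log sum: `∑_{d ∣ n} μ(d) (log n − 2 log d) = 2 Λ(n)` for `n ≠ 1`. -/
theorem sum_divisors_moebius_mul_log_sub {n : ℕ} (hn : n ≠ 1) :
    ∑ d ∈ n.divisors, (μ d : ℝ) * (Real.log n - 2 * Real.log d) = 2 * Λ n := by
  have h1 := sum_divisors_moebius_eq_zero hn
  have h2 : (∑ d ∈ n.divisors, (μ d : ℝ) * Real.log d) = -Λ n := sum_moebius_mul_log_eq
  have : ∑ d ∈ n.divisors, (μ d : ℝ) * (Real.log n - 2 * Real.log d)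
      = Real.log n * ∑ d ∈ n.divisors, (μ d : ℝ) - 2 * ∑ d ∈ n.divisors, (μ d : ℝ) * Real.log d := by
    rw [mul_sum, mul_sum, ← sum_sub_distrib]
    exact sum_congr rfl fun d _ => by ring
  rw [this, h1, h2]; ring

/-- For squarefree `n` and `d ∣ n`: `μ(n/d) = μ(n) μ(d)`. -/
theorem moebius_div_of_squarefree {n d : ℕ} (hn : Squarefree n) (hd : d ∣ n) :
    (μ (n / d) : ℝ) = μ n * μ d := by
  obtain ⟨e, rfl⟩ := hd
  have hd0 : d ≠ 0 := by rintro rfl; simp at hn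
  rw [Nat.mul_div_cancel_left e (Nat.pos_of_ne_zero hd0)]
  have hcop : d.Coprime e := Nat.coprime_of_squarefree_mul hn
  have hmul : μ (d * e) = μ d * μ e := isMultiplicative_moebius.map_mul_of_coprime hcop
  have hdsq : Squarefree d := hn.squarefree_of_dvd (dvd_mul_right d e)
  have hsq : (μ d : ℝ) * μ d = 1 := by
    have := moebius_sq_eq_one_of_squarefree hdsq
    rw [sq] at this
    exact_mod_cast this
  rw [hmul]; push_cast
  calc (μ e : ℝ) = μ e * ((μ d : ℝ) * μ d) := by rw [hsq, mul_one]
    _ = μ d * μ e * μ d := by ring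

/-- A squarefree `n > 1` is not a perfect square: `d * d ≠ n` for every `d`. -/
theorem mul_self_ne_of_squarefree {n d : ℕ} (hn : Squarefree n) (h1 : 1 < n) : d * d ≠ n := by
  intro h
  have hu : IsUnit d := hn d ⟨1, by rw [mul_one]; exact h.symm⟩
  rw [Nat.isUnit_iff] at hu
  subst hu; omega

/-- The upper half of the Möbius–log sum equals `−μ(n)` times the lower half (squarefree `n > 1`). -/
theorem upper_half_eq {n : ℕ} (hn : Squarefree n) (h1 : 1 < n) :
    ∑ d ∈ n.divisors with n < d * d, (μ d : ℝ) * (Real.log n - 2 * Real.log d)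
      = -(μ n : ℝ) * theta n := by
  have hn0 : n ≠ 0 := by omega
  -- rewrite the upper half through the involution `d ↦ n / d`
  let g : ℕ → ℝ := fun d => if n < d * d then (μ d : ℝ) * (Real.log n - 2 * Real.log d) else 0
  have hup : ∑ d ∈ n.divisors with n < d * d, (μ d : ℝ) * (Real.log n - 2 * Real.log d)
      = ∑ d ∈ n.divisors, g (n / d) := by
    rw [Nat.sum_div_divisors n g, sum_filter]
  rw [hup, theta, sum_filter, mul_sum]
  refine sum_congr rfl fun d hd => ?_
  have hdn : d ∣ n := (Nat.mem_divisors.1 hd).1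
  have hd0 : 0 < d := Nat.pos_of_mem_divisors hd
  obtain ⟨e, he⟩ := hdn
  have he0 : 0 < e := Nat.pos_of_ne_zero (by rintro rfl; simp [he] at hn0)
  have hnd : n / d = e := by rw [he, Nat.mul_div_cancel_left e hd0]
  -- `n < (n/d)² ↔ d² < n`
  have hiff : n < e * e ↔ d * d < n := by
    constructor
    · intro h
      by_contra h'
      push Not at h'
      -- d*d ≥ n = d*e ⇒ d ≥ e ⇒ e*e ≤ d*e = n
      have : e ≤ d := by
        by_contra h''; push Not at h''
        have : d * d < d * e := Nat.mul_lt_mul_of_pos_left h'' hd0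
        omega
      have : e * e ≤ d * e := Nat.mul_le_mul_right e this
      rw [he] at h; omega
    · intro h
      have : d < e := by
        by_contra h''; push Not at h''
        have : d * e ≤ d * d := Nat.mul_le_mul_left d h''
        omega
      have : d * e < e * e := Nat.mul_lt_mul_of_pos_right this he0
      rw [he]; exact this
  simp only [g, hnd]
  by_cases hlt : d * d < n
  · rw [if_pos (hiff.2 hlt), if_pos hlt]
    have hμ : (μ e : ℝ) = μ n * μ d := by
      rw [← hnd]; exact moebius_div_of_squarefree hn ⟨e, he⟩
    have hloge : Real.log (e : ℝ) = Real.log n - Real.log d := by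
      have : (e : ℝ) = (n : ℝ) / d := by
        rw [he]; push_cast; field_simp
      rw [this, Real.log_div (by exact_mod_cast hn0) (by exact_mod_cast hd0.ne')]
    rw [hμ, hloge]; ring
  · rw [if_neg (fun h => hlt (hiff.1 h)), if_neg hlt, mul_zero]

/-- **The parity flip.**  For squarefree `n > 1`:  `(1 − μ n) · θ n = 2 Λ n`, where
`θ n = ∑_{d ∣ n, d² < n} μ(d) (log n − 2 log d)` is supported on divisors `d < √n` (level `1/2`). -/
theorem flip {n : ℕ} (hn : Squarefree n) (h1 : 1 < n) :
    (1 - (μ n : ℝ)) * theta n = 2 * Λ n := by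
  have hsplit : ∑ d ∈ n.divisors, (μ d : ℝ) * (Real.log n - 2 * Real.log d)
      = theta n + ∑ d ∈ n.divisors with n < d * d, (μ d : ℝ) * (Real.log n - 2 * Real.log d) := by
    rw [theta, ← sum_filter_add_sum_filter_not n.divisors (fun d => d * d < n)]
    congr 1
    refine sum_congr ?_ fun _ _ => rfl
    ext d
    simp only [mem_filter, not_lt, and_congr_right_iff]
    intro _
    constructor
    · intro h; exact lt_of_le_of_ne h (fun h' => mul_self_ne_of_squarefree hn h1 h'.symm)
    · intro h; exact h.le
  have := sum_divisors_moebius_mul_log_sub (n := n) (by omega)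
  rw [hsplit, upper_half_eq hn h1] at this
  linear_combination this

/-- On integers with an odd number of prime factors the flip is an identity for `Λ`:
`μ n = −1 ⇒ θ n = Λ n`. -/
theorem theta_eq_of_moebius_eq_neg_one {n : ℕ} (hμ : μ n = -1) : theta n = Λ n := by
  have hn : Squarefree n := moebius_ne_zero_iff_squarefree.1 (by rw [hμ]; decide)
  have h1 : 1 < n := by
    rcases Nat.lt_or_ge 1 n with h | h
    · exact h
    · exfalso
      rcases Nat.le_one_iff_eq_zero_or_eq_one.1 h with rfl | rfl
      · simp at hn
      · simp at hμ
  have := flip hn h1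
  rw [hμ] at this; push_cast at this
  linarith

/-- … hence `θ` VANISHES on squarefree composites with an odd number of prime factors. -/
theorem theta_eq_zero_of_odd_composite {n : ℕ} (hμ : μ n = -1) (hp : ¬ n.Prime) : theta n = 0 := by
  rw [theta_eq_of_moebius_eq_neg_one hμ, vonMangoldt_eq_zero_iff]
  intro hpow
  have hn : Squarefree n := moebius_ne_zero_iff_squarefree.1 (by rw [hμ]; decide)
  exact hp (Nat.squarefree_and_prime_pow_iff_prime.1 ⟨hn, hpow⟩)

/-- … and detects primes: `θ p = log p`. -/
theorem theta_prime {p : ℕ} (hp : p.Prime) : theta p = Real.log p := by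
  rw [theta_eq_of_moebius_eq_neg_one (moebius_apply_prime hp), vonMangoldt_apply_prime hp]


end Summit.Parity.BatemanHorn.Theorems.SoloBlindParityFlip
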